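import Summits.Ventures.CertifiedManyBodySolver.Theorems.R2cCruxFromMinSectorFamily
import Summits.Ventures.CertifiedManyBodySolver.Theorems.R2cStripStackLeaf
import HarnessLib

/-!
# R2c — ROW and upper leaves from the SECTOR-PURE seam-stack family (FORMAT `bd-strip-seam-v1` § 2 (L5) as worded), def-free

HONEST FRAMING: first certified bounds; not a superconductivity verdict; every number certified or labelled float.
No energy is asserted here. FORMAT `bd-strip-seam-v1` § 2 (L5) prints its all-`m` / all-`k` finite family SECTOR-PURE («each `ψ_l` in ONE
charge sector `M_l` of the window `|M_l − k·m·Q_c| ≤ m·Δq`, `Σ‖ψ_l‖² = 1`, `Σ_l Re⟨ψ_l, H ψ_l⟩ ≤ k(m·cc + (m−1)σ) + m·β₁ + (m−1)·β₂`»).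
The tree's ROW / RS-leaf turnkeys (`Theorems.m3_tp0_upperRow_of_stripStackFamily_all_sevenEighths`, `…_glideW4Stack`) take the
MEAN-NUMBER wording (`Σ_l Re⟨ψ_l, N ψ_l⟩` in the window), and the sector-pure consumers of `Theorems.R2cCruxFromMinSectorFamily` § 8 need the
STRICT R2c bar with a padding count `k₀`. This file is the missing glue, so that a certificate of ANY endpoint value lands as ONE `exact`:
* § 1 `sum_re_totalNumber_window_of_sectorFamily` — on a sector-pure family the mean number is `Σ_l M_l ‖ψ_l‖²`, hence inside the window
  (`totalNumber_mulVec_of_isNParticle`; Bratteli–Robinson II § 5.2.2);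
* § 2 `m3_tp0_upperRow_of_stripStackSectorFamily` — the ROW `M3EnergyUpperRow 0 ((cc + σ)/(c·W))` at filling `Q_c/(cW) = 7/8` from the
  sector-pure family, NO bar, NO `k₀` (via the mean-number turnkey with `B m := m·β₁ + (m−1)·β₂`, `q m := m·q₁`);
* § 3 the RS leaf (`(cc + σ)/(cW) ≤ −12525490015723/2⁴⁴`) and the R2c leaf with the NON-strict bar (`≤ −18/25`; the crux path § 8 of
  `R2cCruxFromMinSectorFamily` needs `<`) from the same sentence;
* § 4 the `W = 4` glide-stack specialisations (`c = 16`, `Q_c = 56`, 64-site period; S3 «SEAM-CERT2» j276048 / S4 «PLAQ-SEAM-W4»): an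
  RS-class certificate (S3 forecast `B_drs ≈ −45.86` per period [FLOAT], between the RS bar `−45.567…` and the R2c bar `−46.08`) then gives the
  CERTIFIED row `e₀(1,0,8; 7/8) ≤ B_drs/64` by `m3_tp0_upperRow_of_glideW4SectorFamily`, an R2c-class one the leaf AND (§ 8, strict) both cruxes.
Pen candidate (sr-mbsolver-var-7 g23); a prover lands it as `Theorems/R2cSectorFamilyRow.lean`.
-/

noncomputable section

open Matrix Finset
open scoped ComplexOrder BigOperators

namespace Summit.Ventures.CertifiedManyBodySolver.Theorems

open Literature.MathematicalPhysics.QuantumLattice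
open Literature.MathematicalPhysics.QuantumLattice.ThermodynamicLimit
open Summit.Ventures.CertifiedManyBodySolver.MbsolverRungLeaves

/-! ## § 1 Mean number of a sector-pure family -/

/-- On an `M`-particle vector `Re⟨ψ, N ψ⟩ = M ‖ψ‖²`. [folklore] -/
theorem re_dotProduct_totalNumber_of_isNParticle {Λ : Type*} [LinearOrder Λ] [Fintype Λ] {M : ℕ} {ψ : Fock (Orb Λ)}
    (hψ : IsNParticle M ψ) : (star ψ ⬝ᵥ (totalNumber *ᵥ ψ)).re = (M : ℝ) * (star ψ ⬝ᵥ ψ).re := by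
  rw [totalNumber_mulVec_of_isNParticle hψ, dotProduct_smul, smul_eq_mul]
  simp [Complex.mul_re]

/-- **Mean number of a sector-pure family lies in the sector window**: if each `ψ_l` is in the `M_l`-particle sector with
`lo ≤ M_l ≤ hi` and `Σ‖ψ_l‖² = 1`, then `lo ≤ Σ_l Re⟨ψ_l, N ψ_l⟩ ≤ hi`. [folklore] -/
theorem sum_re_totalNumber_window_of_sectorFamily {Λ : Type*} [LinearOrder Λ] [Fintype Λ] {n : ℕ}
    (ψ : Fin n → Fock (Orb Λ)) (Msec : Fin n → ℕ) (hsec : ∀ l, IsNParticle (Msec l) (ψ l))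
    (hS : ∑ l, (star (ψ l) ⬝ᵥ ψ l).re = 1) {lo hi : ℝ} (hwin : ∀ l, lo ≤ (Msec l : ℝ) ∧ (Msec l : ℝ) ≤ hi) :
    lo ≤ ∑ l, (star (ψ l) ⬝ᵥ (totalNumber *ᵥ ψ l)).re ∧ ∑ l, (star (ψ l) ⬝ᵥ (totalNumber *ᵥ ψ l)).re ≤ hi := by
  have hw : ∀ l, 0 ≤ (star (ψ l) ⬝ᵥ ψ l).re := fun l =>
    (Complex.nonneg_iff.1 (dotProduct_star_self_nonneg (ψ l))).1
  have key : ∑ l, (star (ψ l) ⬝ᵥ (totalNumber *ᵥ ψ l)).re = ∑ l, (Msec l : ℝ) * (star (ψ l) ⬝ᵥ ψ l).re :=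
    Finset.sum_congr rfl fun l _ => re_dotProduct_totalNumber_of_isNParticle (hsec l)
  rw [key]
  constructor
  · calc lo = ∑ l, lo * (star (ψ l) ⬝ᵥ ψ l).re := by rw [← Finset.mul_sum, hS, mul_one]
      _ ≤ ∑ l, (Msec l : ℝ) * (star (ψ l) ⬝ᵥ ψ l).re :=
        Finset.sum_le_sum fun l _ => mul_le_mul_of_nonneg_right (hwin l).1 (hw l)
  · calc ∑ l, (Msec l : ℝ) * (star (ψ l) ⬝ᵥ ψ l).re ≤ ∑ l, hi * (star (ψ l) ⬝ᵥ ψ l).re :=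
        Finset.sum_le_sum fun l _ => mul_le_mul_of_nonneg_right (hwin l).2 (hw l)
      _ = hi := by rw [← Finset.mul_sum, hS, mul_one]

/-! ## § 2 ROW from the sector-pure seam-stack family (generic cell, filling 7/8; no bar, no padding) -/

/-- **Sector-pure ⇒ mean-number seam-stack family.** The FORMAT (L5) sector-pure sentence implies the tree's mean-number family
sentence with `B m := m·β₁ + (m−1)·β₂` and `q m := m·q₁`. [folklore] -/
theorem stripStackFamily_all_of_sectorFamily (c W Qc q₁ : ℕ) (cc σ β₁ β₂ : ℚ)
    (hfam : ∀ m : ℕ, 1 ≤ m → ∀ k : ℕ, 1 ≤ k → ∃ n : ℕ, ∃ ψ : Fin n → Fock (Orb (Fin (k * c) ×ₗ Fin (m * W))),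
      ∃ Msec : Fin n → ℕ, (∀ l, IsNParticle (Msec l) (ψ l)) ∧
      (∀ l, k * (m * Qc) ≤ Msec l + m * q₁ ∧ Msec l ≤ k * (m * Qc) + m * q₁) ∧
      ∑ l, (star (ψ l) ⬝ᵥ ψ l).re = 1 ∧
      ∑ l, (star (ψ l) ⬝ᵥ (hubbardOpenBoxTT' (k * c) (m * W) 1 0 8 *ᵥ ψ l)).re ≤
        ((((k : ℚ) * ((m : ℚ) * cc + ((m : ℚ) - 1) * σ) + (m : ℚ) * β₁ + ((m : ℚ) - 1) * β₂ : ℚ)) : ℝ)) :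
    ∀ m : ℕ, 1 ≤ m → ∀ k : ℕ, 1 ≤ k → ∃ n : ℕ, ∃ ψ : Fin n → Fock (Orb (Fin (k * c) ×ₗ Fin (m * W))),
      ∑ l, (star (ψ l) ⬝ᵥ ψ l).re = 1 ∧
      ∑ l, (star (ψ l) ⬝ᵥ (hubbardOpenBoxTT' (k * c) (m * W) 1 0 8 *ᵥ ψ l)).re ≤
        ((((k : ℚ) * ((m : ℚ) * cc + ((m : ℚ) - 1) * σ) +
          (fun m : ℕ => (m : ℚ) * β₁ + ((m : ℚ) - 1) * β₂) m : ℚ)) : ℝ) ∧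
      ((((k : ℚ) * ((m : ℚ) * ((Qc : ℤ) : ℚ)) - (fun m : ℕ => (m : ℚ) * (q₁ : ℚ)) m : ℚ)) : ℝ) ≤
          ∑ l, (star (ψ l) ⬝ᵥ (totalNumber *ᵥ ψ l)).re ∧
      ∑ l, (star (ψ l) ⬝ᵥ (totalNumber *ᵥ ψ l)).re ≤
          ((((k : ℚ) * ((m : ℚ) * ((Qc : ℤ) : ℚ)) + (fun m : ℕ => (m : ℚ) * (q₁ : ℚ)) m : ℚ)) : ℝ) := by
  intro m hm k hk
  obtain ⟨n, ψ, Msec, hsec, hwin, hS, hE⟩ := hfam m hm k hk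
  have hwinR : ∀ l, ((k : ℝ) * ((m : ℝ) * (Qc : ℝ)) - (m : ℝ) * (q₁ : ℝ)) ≤ (Msec l : ℝ) ∧
      (Msec l : ℝ) ≤ (k : ℝ) * ((m : ℝ) * (Qc : ℝ)) + (m : ℝ) * (q₁ : ℝ) := by
    intro l
    have h1 : ((k * (m * Qc) : ℕ) : ℝ) ≤ ((Msec l + m * q₁ : ℕ) : ℝ) := by exact_mod_cast (hwin l).1
    have h2 : ((Msec l : ℕ) : ℝ) ≤ ((k * (m * Qc) + m * q₁ : ℕ) : ℝ) := by exact_mod_cast (hwin l).2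
    push_cast at h1 h2
    exact ⟨by linarith, by linarith⟩
  obtain ⟨hlo, hhi⟩ := sum_re_totalNumber_window_of_sectorFamily ψ Msec hsec hS hwinR
  refine ⟨n, ψ, hS, le_of_le_of_eq hE ?_, ?_, ?_⟩
  · push_cast; ring
  · refine le_of_eq_of_le ?_ hlo
    push_cast; ring
  · refine le_of_le_of_eq hhi ?_
    push_cast; ring

/-- **ROW from the sector-pure all-`m` seam-stack family at filling `7/8`** (`t′ = 0`, `U = 8`; any cell `c × W` with `8·Q_c = 7·c·W`):
`e₀(1,0,8; 7/8) ≤ (cc + σ)/(c·W)` — no bar, no padding count. [folklore] -/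
theorem m3_tp0_upperRow_of_stripStackSectorFamily {c W : ℕ} (hc : 1 ≤ c) (hW : 1 ≤ W) {Qc : ℕ}
    (hfill : 8 * Qc = 7 * (c * W)) (q₁ : ℕ) (cc σ β₁ β₂ : ℚ)
    (hfam : ∀ m : ℕ, 1 ≤ m → ∀ k : ℕ, 1 ≤ k → ∃ n : ℕ, ∃ ψ : Fin n → Fock (Orb (Fin (k * c) ×ₗ Fin (m * W))),
      ∃ Msec : Fin n → ℕ, (∀ l, IsNParticle (Msec l) (ψ l)) ∧
      (∀ l, k * (m * Qc) ≤ Msec l + m * q₁ ∧ Msec l ≤ k * (m * Qc) + m * q₁) ∧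
      ∑ l, (star (ψ l) ⬝ᵥ ψ l).re = 1 ∧
      ∑ l, (star (ψ l) ⬝ᵥ (hubbardOpenBoxTT' (k * c) (m * W) 1 0 8 *ᵥ ψ l)).re ≤
        ((((k : ℚ) * ((m : ℚ) * cc + ((m : ℚ) - 1) * σ) + (m : ℚ) * β₁ + ((m : ℚ) - 1) * β₂ : ℚ)) : ℝ)) :
    M3EnergyUpperRow 0 ((cc + σ) / ((c : ℚ) * (W : ℚ))) :=
  m3_tp0_upperRow_of_stripStackFamily_all_sevenEighths hc hW (Qc := (Qc : ℤ)) (by exact_mod_cast hfill) cc σ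
    (fun m : ℕ => (m : ℚ) * β₁ + ((m : ℚ) - 1) * β₂) (fun m : ℕ => (m : ℚ) * (q₁ : ℚ))
    (stripStackFamily_all_of_sectorFamily c W Qc q₁ cc σ β₁ β₂ hfam)

/-! ## § 3 The RS leaf and the (non-strict) R2c leaf from the sector-pure family (generic cell) -/

/-- **RS leaf** `M3Upper_tp0_le_RS` from the sector-pure family when `(cc + σ)/(c·W) ≤ −12525490015723/2⁴⁴` (CERTIFIED #524's value). [folklore] -/
theorem m3Upper_tp0_le_RS_of_stripStackSectorFamily {c W : ℕ} (hc : 1 ≤ c) (hW : 1 ≤ W) {Qc : ℕ}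
    (hfill : 8 * Qc = 7 * (c * W)) (q₁ : ℕ) (cc σ β₁ β₂ : ℚ)
    (hbar : (cc + σ) / ((c : ℚ) * (W : ℚ)) ≤ -12525490015723 / 17592186044416)
    (hfam : ∀ m : ℕ, 1 ≤ m → ∀ k : ℕ, 1 ≤ k → ∃ n : ℕ, ∃ ψ : Fin n → Fock (Orb (Fin (k * c) ×ₗ Fin (m * W))),
      ∃ Msec : Fin n → ℕ, (∀ l, IsNParticle (Msec l) (ψ l)) ∧
      (∀ l, k * (m * Qc) ≤ Msec l + m * q₁ ∧ Msec l ≤ k * (m * Qc) + m * q₁) ∧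
      ∑ l, (star (ψ l) ⬝ᵥ ψ l).re = 1 ∧
      ∑ l, (star (ψ l) ⬝ᵥ (hubbardOpenBoxTT' (k * c) (m * W) 1 0 8 *ᵥ ψ l)).re ≤
        ((((k : ℚ) * ((m : ℚ) * cc + ((m : ℚ) - 1) * σ) + (m : ℚ) * β₁ + ((m : ℚ) - 1) * β₂ : ℚ)) : ℝ)) :
    M3Upper_tp0_le_RS :=
  ⟨(cc + σ) / ((c : ℚ) * (W : ℚ)), hbar, m3_tp0_upperRow_of_stripStackSectorFamily hc hW hfill q₁ cc σ β₁ β₂ hfam⟩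

/-- **R2c leaf** `M3Upper_tp0_le_m18o25` (the `closes` conclusion of route `R2cOpenStripTangentLine`) from the sector-pure family with the
NON-strict bar `(cc + σ)/(c·W) ≤ −18/25` and no padding count (the crux path `bothFamiliesBelowLine_of_stripStackSectorFamily` needs
the strict bar and a `k₀`). [folklore] -/
theorem m3Upper_tp0_le_m18o25_of_stripStackSectorFamily_nonstrict {c W : ℕ} (hc : 1 ≤ c) (hW : 1 ≤ W) {Qc : ℕ}
    (hfill : 8 * Qc = 7 * (c * W)) (q₁ : ℕ) (cc σ β₁ β₂ : ℚ)
    (hbar : (cc + σ) / ((c : ℚ) * (W : ℚ)) ≤ -18 / 25)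
    (hfam : ∀ m : ℕ, 1 ≤ m → ∀ k : ℕ, 1 ≤ k → ∃ n : ℕ, ∃ ψ : Fin n → Fock (Orb (Fin (k * c) ×ₗ Fin (m * W))),
      ∃ Msec : Fin n → ℕ, (∀ l, IsNParticle (Msec l) (ψ l)) ∧
      (∀ l, k * (m * Qc) ≤ Msec l + m * q₁ ∧ Msec l ≤ k * (m * Qc) + m * q₁) ∧
      ∑ l, (star (ψ l) ⬝ᵥ ψ l).re = 1 ∧
      ∑ l, (star (ψ l) ⬝ᵥ (hubbardOpenBoxTT' (k * c) (m * W) 1 0 8 *ᵥ ψ l)).re ≤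
        ((((k : ℚ) * ((m : ℚ) * cc + ((m : ℚ) - 1) * σ) + (m : ℚ) * β₁ + ((m : ℚ) - 1) * β₂ : ℚ)) : ℝ)) :
    M3Upper_tp0_le_m18o25 :=
  ⟨(cc + σ) / ((c : ℚ) * (W : ℚ)), hbar, m3_tp0_upperRow_of_stripStackSectorFamily hc hW hfill q₁ cc σ β₁ β₂ hfam⟩

/-! ## § 4 The W = 4 glide stack (`c = 16`, `Q_c = 56`, 64-site period): S3 «SEAM-CERT2» / S4 «PLAQ-SEAM-W4» objects -/

/-- **ROW for the W = 4 glide stack from the sector-pure family**: `e₀(1,0,8; 7/8) ≤ (cc + σ)/64` — any value, no bar. [folklore] -/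
theorem m3_tp0_upperRow_of_glideW4SectorFamily (q₁ : ℕ) (cc σ β₁ β₂ : ℚ)
    (hfam : ∀ m : ℕ, 1 ≤ m → ∀ k : ℕ, 1 ≤ k → ∃ n : ℕ, ∃ ψ : Fin n → Fock (Orb (Fin (k * 16) ×ₗ Fin (m * 4))),
      ∃ Msec : Fin n → ℕ, (∀ l, IsNParticle (Msec l) (ψ l)) ∧
      (∀ l, k * (m * 56) ≤ Msec l + m * q₁ ∧ Msec l ≤ k * (m * 56) + m * q₁) ∧
      ∑ l, (star (ψ l) ⬝ᵥ ψ l).re = 1 ∧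
      ∑ l, (star (ψ l) ⬝ᵥ (hubbardOpenBoxTT' (k * 16) (m * 4) 1 0 8 *ᵥ ψ l)).re ≤
        ((((k : ℚ) * ((m : ℚ) * cc + ((m : ℚ) - 1) * σ) + (m : ℚ) * β₁ + ((m : ℚ) - 1) * β₂ : ℚ)) : ℝ)) :
    M3EnergyUpperRow 0 ((cc + σ) / 64) := by
  have h := m3_tp0_upperRow_of_stripStackSectorFamily (c := 16) (W := 4) (by norm_num) (by norm_num) (Qc := 56)
    (by norm_num) q₁ cc σ β₁ β₂ hfam
  have h64 : ((cc + σ) / (((16 : ℕ) : ℚ) * ((4 : ℕ) : ℚ)) : ℚ) = (cc + σ) / 64 := by norm_num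
  rw [h64] at h
  exact h

/-- **RS leaf for the W = 4 glide stack from the sector-pure family**: bar `cc + σ ≤ −12525490015723/274877906944`
(= `−45.567…` per 64-site period). [folklore] -/
theorem m3Upper_tp0_le_RS_of_glideW4SectorFamily (q₁ : ℕ) (cc σ β₁ β₂ : ℚ)
    (hbar : cc + σ ≤ -12525490015723 / 274877906944)
    (hfam : ∀ m : ℕ, 1 ≤ m → ∀ k : ℕ, 1 ≤ k → ∃ n : ℕ, ∃ ψ : Fin n → Fock (Orb (Fin (k * 16) ×ₗ Fin (m * 4))),
      ∃ Msec : Fin n → ℕ, (∀ l, IsNParticle (Msec l) (ψ l)) ∧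
      (∀ l, k * (m * 56) ≤ Msec l + m * q₁ ∧ Msec l ≤ k * (m * 56) + m * q₁) ∧
      ∑ l, (star (ψ l) ⬝ᵥ ψ l).re = 1 ∧
      ∑ l, (star (ψ l) ⬝ᵥ (hubbardOpenBoxTT' (k * 16) (m * 4) 1 0 8 *ᵥ ψ l)).re ≤
        ((((k : ℚ) * ((m : ℚ) * cc + ((m : ℚ) - 1) * σ) + (m : ℚ) * β₁ + ((m : ℚ) - 1) * β₂ : ℚ)) : ℝ)) :
    M3Upper_tp0_le_RS :=
  ⟨(cc + σ) / 64, by linarith, m3_tp0_upperRow_of_glideW4SectorFamily q₁ cc σ β₁ β₂ hfam⟩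

/-- **R2c leaf for the W = 4 glide stack from the sector-pure family, NON-strict bar** `cc + σ ≤ −1152/25` (= `−46.08` per period),
no padding count; at `cc + σ < −1152/25` use `bothFamiliesBelowLine_of_glideW4SectorFamily` for the cruxes as well. [folklore] -/
theorem m3Upper_tp0_le_m18o25_of_glideW4SectorFamily_nonstrict (q₁ : ℕ) (cc σ β₁ β₂ : ℚ) (hbar : cc + σ ≤ -1152 / 25)
    (hfam : ∀ m : ℕ, 1 ≤ m → ∀ k : ℕ, 1 ≤ k → ∃ n : ℕ, ∃ ψ : Fin n → Fock (Orb (Fin (k * 16) ×ₗ Fin (m * 4))),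
      ∃ Msec : Fin n → ℕ, (∀ l, IsNParticle (Msec l) (ψ l)) ∧
      (∀ l, k * (m * 56) ≤ Msec l + m * q₁ ∧ Msec l ≤ k * (m * 56) + m * q₁) ∧
      ∑ l, (star (ψ l) ⬝ᵥ ψ l).re = 1 ∧
      ∑ l, (star (ψ l) ⬝ᵥ (hubbardOpenBoxTT' (k * 16) (m * 4) 1 0 8 *ᵥ ψ l)).re ≤
        ((((k : ℚ) * ((m : ℚ) * cc + ((m : ℚ) - 1) * σ) + (m : ℚ) * β₁ + ((m : ℚ) - 1) * β₂ : ℚ)) : ℝ)) :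
    M3Upper_tp0_le_m18o25 :=
  ⟨(cc + σ) / 64, by linarith, m3_tp0_upperRow_of_glideW4SectorFamily q₁ cc σ β₁ β₂ hfam⟩

/-! ## § 5 Bar arithmetic by value for the S3 forecast class (no energy asserted) -/

/-- The S3 forecast class by value: a per-period endpoint of `−45.86 = −2293/50` [the FLOAT forecast, used here only as a rational test value]
beats the RS bar (`−45.567…`) but not the R2c bar (`−46.08`), and its per-site value `−2293/3200 = −0.7165625` improves #524's
`−12525490015723/2⁴⁴ = −0.71199…` by more than `9/2000`. [folklore] -/
theorem glideW4Stack_S3class_by_value :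
    (-2293 / 50 : ℚ) ≤ -12525490015723 / 274877906944 ∧
    ¬ ((-2293 / 50 : ℚ) ≤ -1152 / 25) ∧
    (-2293 / 50 : ℚ) / 64 = -2293 / 3200 ∧
    (-2293 / 3200 : ℚ) + 9 / 2000 < -12525490015723 / 17592186044416 := by
  refine ⟨by norm_num, by norm_num, by norm_num, by norm_num⟩

end Summit.Ventures.CertifiedManyBodySolver.Theorems

end
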